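import Literature.NumberTheory.EllipticCurves.PadicSigmaVeluKernelBridgeProofs
import Literature.NumberTheory.EllipticCurves.CanonicalKernelProofs
import Literature.NumberTheory.EllipticCurves.CanonicalKernelHenselProofs
import Mathlib.Algebra.Polynomial.Lifts
import Mathlib.Algebra.Polynomial.BigOperators
import HarnessLib

/-!
# Vélu kernel data for the universal ordinary curve from the canonical subgroup over a
# generic-fibre valuation ring (Blakestad–Grant 2023, Prop. 7; proofs only)

Trunk T-NT-EC (Literature/NumberTheory/EllipticCurves). The tree's
`mazur_tate_sigma_existsUnique_of_veluKernelData` (`PadicSigmaVeluKernelBridgeProofs`) reduces the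
named fact `WeierstrassCurve.mazur_tate_sigma_existsUnique` (Mazur–Stein–Tate 2006, Thm. 1.3) to
POLYNOMIAL data over Blakestad–Grant's ring `R̂ = completeRing p`: the canonical factor
`φ = φ_ψ` of `ψ_p` (`CanonicalKernelHenselProofs.exists_canonicalFactor`) together with lifts
`U₀, M₀ ∈ R̂[X]`, `A₀, B₀ ∈ R̂` of Vélu's numerators and coefficients for the subgroup cut out by
`φ`, and the Kohel form `U₀ = (pX - T₀)D² - 𝓛(D)`, `pD = φ`, over `K = R̂[1/p]`.

This file produces that data (`exists_veluKernelData_of_rings`) from the tree's point-level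
theory — `CanonicalKernelProofs.exists_canonicalKernel` (the canonical subgroup
`G = E[p] ∩ E₁` over an algebraically closed valued field, `φ = p·veluD G`),
`VeluKernelReductionProofs.exists_veluU_lift / exists_veluMD_lift / exists_veluAB_lift`
(Blakestad–Grant Prop. 7 (a): integral lifts over a local base `𝒪`, congruent to `Xᵖ`, `fⁿ`,
`A₄ᵖ/ℓ₀⁴`, `A₆ᵖ/ℓ₀⁶`), `VeluLogDerivativeProofs` / `PadicSigmaKohelCriterionProofs.veluU_eq_logForm`
(Kohel form) — for an ABSTRACT tower of rings

  `R̂ → 𝒪 → K₀ → F ⊇ S → k`,  `R̂ → K = R̂[1/p] → K₀`,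

axiomatising the generic fibre: `𝒪` a local domain through which `R̂ → Frac R̂ = K₀` factors
(in the application `𝒪 = R̂_{(p)}`), `F` an algebraic closure of `K₀`, `S ⊆ F` a valuation ring
dominating `𝒪` (`hker`, `hunit`), integrally closed in `F` (`hint`), with `S ∩ K₀ = 𝒪` (`hOK`),
residue ring `k` of characteristic `p`, and the DESCENT property `K ∩ 𝒪 = R̂` inside `K₀`
(`hdesc`: an element of `R̂[1/p]` which is `p`-integral on the generic fibre lies in `R̂`).
The construction of such a tower for `R̂` is `PadicSigmaExistenceProofs`.

Descent (the only new argument): Vélu's `U`, `M = U'D - 2UD'`, `a`, `b` are `K`-rational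
(`D = φ/p ∈ K[X]`, the explicit/Kohel form of `U`, and `a, b` read off as coefficients of
`fM² - U³ = aUD⁴ + bD⁶`) and `𝒪`-integral (Prop. 7 (a)), hence have coefficients in `R̂`; the
congruences modulo `p` descend because `pR̂ = R̂ ∩ p𝒪`.

## Sources

* C. Blakestad, D. Grant, J. Number Theory 249 (2023) (arXiv:1903.02480), Prop. 7 and its proof,
  Lemmas 10–12. [BlakestadGrant2023]
* J. Vélu, C. R. Acad. Sci. Paris 273 (1971) 238–241; D. Kohel, thesis (1996) §2.4. [Velu1971]
* B. Mazur, W. Stein, J. Tate, Doc. Math. Extra Vol. Coates (2006), Thm. 1.3. [MazurSteinTate2006]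

Pure proof file: no definitions, no named facts.
-/

noncomputable section

open scoped Classical
open Polynomial WeierstrassCurve WeierstrassCurve.Affine.Point

namespace Literature.NumberTheory.EllipticCurves.UniversalOrdinary

/-! ### Descent helpers -/

section Descent

variable {R 𝒪 K K₀ F : Type*} [CommRing R] [CommRing 𝒪] [CommRing K] [Field K₀] [Field F]
  (αK : R →+* K) (jR : R →+* 𝒪) (j : 𝒪 →+* K₀) (iK : K →+* K₀) (ι₀ : K₀ →+* F)

/-- Descent of polynomials: a polynomial over `K` and one over `𝒪` with the same image in `F`
come from one polynomial over `R`, provided single coefficients descend. [folklore] -/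
theorem exists_poly_descend (hiK : iK.comp αK = j.comp jR) (hji : Function.Injective j)
    (hdesc : ∀ (x : K) (y : 𝒪), iK x = j y → ∃ r : R, αK r = x)
    {qK : K[X]} {qO : 𝒪[X]} (h : qK.map (ι₀.comp iK) = qO.map (ι₀.comp j)) :
    ∃ q : R[X], q.map αK = qK ∧ q.map jR = qO := by
  have hKO : qK.map iK = qO.map j := by
    apply Polynomial.map_injective ι₀ ι₀.injective
    rwa [Polynomial.map_map, Polynomial.map_map]
  have hlift : qK ∈ Polynomial.lifts αK := by
    rw [Polynomial.lifts_iff_coeff_lifts]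
    intro i
    obtain ⟨r, hr⟩ := hdesc (qK.coeff i) (qO.coeff i) (by
      rw [← Polynomial.coeff_map, ← Polynomial.coeff_map, hKO])
    exact ⟨r, hr⟩
  obtain ⟨q, hq⟩ := (Polynomial.mem_lifts _).mp hlift
  refine ⟨q, hq, Polynomial.map_injective j hji ?_⟩
  rw [Polynomial.map_map, ← hiK, ← Polynomial.map_map, hq, hKO]

/-- Descent of divisibility by `p`: `p ∣ jR r` in `𝒪` gives `p ∣ r` in `R` when `R → K` inverts
`p`, is injective, and `K ∩ 𝒪 = R`. [folklore] -/
theorem dvd_descend (hiK : iK.comp αK = j.comp jR) (hαK : Function.Injective αK)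
    (hdesc : ∀ (x : K) (y : 𝒪), iK x = j y → ∃ r : R, αK r = x)
    {p : R} (hpK : IsUnit (αK p)) (hpO : j (jR p) ≠ 0) {r : R} (h : jR p ∣ jR r) : p ∣ r := by
  obtain ⟨y, hy⟩ := h
  set x : K := αK r * ↑hpK.unit⁻¹ with hx
  have hxy : iK x = j y := by
    have h1 : iK (αK p) = j (jR p) := RingHom.congr_fun hiK p
    have h2 : iK (αK r) = j (jR r) := RingHom.congr_fun hiK r
    have h3 : iK (αK p) * iK (↑hpK.unit⁻¹ : K) = 1 := by rw [← map_mul, IsUnit.mul_val_inv, map_one]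
    apply mul_left_cancel₀ hpO
    rw [← h1, hx, map_mul, ← mul_assoc, mul_comm (iK (αK p)), mul_assoc, h3, mul_one, h2, hy, map_mul, h1]
  obtain ⟨r', hr'⟩ := hdesc x y hxy
  refine ⟨r', hαK ?_⟩
  rw [map_mul, hr', hx, mul_comm (αK r), ← mul_assoc, IsUnit.mul_val_inv, one_mul]

end Descent

/-! ### Units and roots over the valuation ring -/

section Units

variable {𝒪 S F : Type*} [CommRing 𝒪] [CommRing S] [Field F] (ι : 𝒪 →+* S) [Algebra S F]

/-- `q^ι(s) - ι(q₀)` is divisible by `ι(p)` when `p ∣ qᵢ` for `i ≥ 1`. [folklore] -/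
theorem dvd_eval_map_sub {p : 𝒪} {q : 𝒪[X]} (hq : ∀ i, 1 ≤ i → p ∣ q.coeff i) (s : S) :
    ι p ∣ (q.map ι).eval s - ι (q.coeff 0) := by
  rw [Polynomial.eval_eq_sum_range' (Nat.lt_succ_of_le Polynomial.natDegree_map_le), Finset.sum_range_succ',
    pow_zero, mul_one, Polynomial.coeff_map, add_sub_cancel_right]
  refine Finset.dvd_sum fun i _ => ?_
  rw [Polynomial.coeff_map]
  exact Dvd.dvd.mul_right (map_dvd ι (hq (i + 1) (Nat.succ_pos i))) _

variable [IsLocalRing S]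

/-- In a local ring containing `p` in its maximal ideal, `x ≡ unit (mod p)` is a unit. [folklore] -/
theorem isUnit_of_dvd_sub {p : 𝒪} (hp : ι p ∈ IsLocalRing.maximalIdeal S) {x y : S} (hy : IsUnit y)
    (h : ι p ∣ x - y) : IsUnit x := by
  by_contra hx
  have hxm : x ∈ IsLocalRing.maximalIdeal S := (IsLocalRing.mem_maximalIdeal _).mpr hx
  have hsub : x - y ∈ IsLocalRing.maximalIdeal S := by
    obtain ⟨c, hc⟩ := h; rw [hc]; exact Ideal.mul_mem_right _ _ hp
  have hym : y ∈ IsLocalRing.maximalIdeal S := by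
    have := Ideal.sub_mem _ hxm hsub; rwa [sub_sub_cancel] at this
  exact (IsLocalRing.mem_maximalIdeal _).mp hym hy

/-- `φ^ι(s)` is a unit when `φ ≡ φ₀ (mod p)` with `φ₀` a unit and `p ∈ 𝔪_S`. [folklore] -/
theorem isUnit_eval_map {p : 𝒪} (hp : ι p ∈ IsLocalRing.maximalIdeal S) {q : 𝒪[X]}
    (hq : ∀ i, 1 ≤ i → p ∣ q.coeff i) (h0 : IsUnit (q.coeff 0)) (s : S) : IsUnit ((q.map ι).eval s) :=
  isUnit_of_dvd_sub ι hp (h0.map ι) (dvd_eval_map_sub ι hq s)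

end Units

/-! ### The universal curve is elliptic on the generic fibre: `Δ ∉ pR̂` -/

section Delta

open Literature.RingTheory.AdicTopology

variable (p : ℕ) [Fact p.Prime]

/-- `Δ(y² = x³ + x) = -64`. [folklore] -/
theorem delta_curve_one_zero {A : Type*} [CommRing A] : (⟨0, 0, 0, 1, 0⟩ : WeierstrassCurve A).Δ = -64 := by
  simp only [WeierstrassCurve.Δ, WeierstrassCurve.b₂, WeierstrassCurve.b₄, WeierstrassCurve.b₆, WeierstrassCurve.b₈]
  norm_num

/-- `Δ ∉ (p)` in `ℤ[A₄, A₆]` for `p ≥ 5` (specialise to `y² = x³ + x`, `Δ = -64`). [folklore] -/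
theorem delta_curve_not_mem_span (hp5 : 5 ≤ p) : curve.Δ ∉ Ideal.span {(p : coeffRing)} := by
  have hpp : p.Prime := Fact.out
  intro hmem
  set f : coeffRing →+* ZMod p := MvPolynomial.eval₂Hom (Int.castRingHom (ZMod p)) ![1, 0] with hf
  have hΔ : f curve.Δ = -64 := by
    rw [← WeierstrassCurve.map_Δ, hf, curve_map_eval₂Hom, delta_curve_one_zero]
  have hzero : f curve.Δ = 0 := by
    obtain ⟨c, hc⟩ := Ideal.mem_span_singleton.mp hmem
    rw [hc, map_mul, map_natCast, ZMod.natCast_self, zero_mul]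
  rw [hzero] at hΔ
  have h64 : ((64 : ℕ) : ZMod p) = 0 := by
    have := hΔ.symm; rw [neg_eq_zero] at this; exact_mod_cast this
  rw [ZMod.natCast_eq_zero_iff] at h64
  have h2 : p ∣ 2 := hpp.dvd_of_dvd_pow (show p ∣ 2 ^ 6 by norm_num; exact h64)
  have := Nat.le_of_dvd two_pos h2
  omega

/-- **`Δ(𝓔) ∉ pR̂`** (`p ≥ 5`): the universal ordinary curve has good reduction on the generic fibre.
[folklore] -/
theorem delta_universalCurve_not_mem_span (hp5 : 5 ≤ p) :
    (universalCurve p).Δ ∉ Ideal.span {(p : completeRing p)} := by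
  have hpp : p.Prime := Fact.out
  -- in `R_H = ℤ[A₄,A₆][1/H]`
  have hloc : algebraMap coeffRing (localizedRing p) curve.Δ ∉ Ideal.span {(p : localizedRing p)} := by
    intro hmem
    obtain ⟨y, hy⟩ := Ideal.mem_span_singleton.mp hmem
    obtain ⟨⟨c, m⟩, hcm⟩ := IsLocalization.surj (Submonoid.powers (hasse p)) y
    obtain ⟨k, hk⟩ := m.2
    have hk' : hasse p ^ k = (m : coeffRing) := hk
    have h1 : algebraMap coeffRing (localizedRing p) (curve.Δ * hasse p ^ k) =
        algebraMap coeffRing (localizedRing p) ((p : coeffRing) * c) := by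
      rw [map_mul, map_mul, map_natCast, hy, hk', mul_assoc]
      exact congrArg _ hcm
    have h2 : curve.Δ * hasse p ^ k ∈ Ideal.span {(p : coeffRing)} :=
      Ideal.mem_span_singleton.mpr ⟨c, algebraMap_localizedRing_injective p hp5 h1⟩
    rcases (span_natCast_isPrime p).mem_or_mem h2 with h3 | h3
    · exact delta_curve_not_mem_span p hp5 h3
    · exact hasse_not_mem_span p hp5 ((span_natCast_isPrime p).mem_of_pow_mem k h3)
  -- in `R̂`
  intro hmem
  rw [← curve_map_algebraMap, WeierstrassCurve.map_Δ, algebraMap_coeffRing_apply] at hmem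
  set x := algebraMap coeffRing (localizedRing p) curve.Δ with hx
  have h := (evalₐ_eq_zero_iff (p : localizedRing p) (n := 1)
    (algebraMap (localizedRing p) (completeRing p) x)).mpr (by
      rw [pow_one, algebraMap_natCast]; exact hmem)
  rw [algebraMap_eq_of, AdicCompletion.evalₐ_of, Ideal.Quotient.eq_zero_iff_mem, pow_one] at h
  exact hloc h

end Delta

/-! ### Transport of a kernel along an equality of curves -/

section Transport

variable {F : Type*} [Field F]

/-- A finite subgroup transported along an equality of Weierstrass curves keeps its Vélu data.
[folklore] -/
theorem exists_kernel_cast {W₁ W₂ : WeierstrassCurve F} (e : W₁ = W₂) {G : Finset W₁.toAffine.Point}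
    (hG : IsOddSubgroupFinset G) :
    ∃ G₂ : Finset W₂.toAffine.Point, IsOddSubgroupFinset G₂ ∧ veluXVals G₂ = veluXVals G ∧
      veluD G₂ = veluD G ∧ veluU G₂ = veluU G ∧ veluMD G₂ = veluMD G ∧
      (G₂.erase 0).card = (G.erase 0).card ∧ ∑ v ∈ G₂.erase 0, xOf v = ∑ v ∈ G.erase 0, xOf v := by
  subst e
  exact ⟨G, hG, rfl, rfl, rfl, rfl, rfl, rfl⟩

end Transport

/-! ### The Vélu kernel data of the canonical subgroup -/

section Main

variable (p : ℕ) [Fact p.Prime]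

set_option maxHeartbeats 800000 in
/-- **Vélu kernel data of the canonical subgroup of the universal ordinary curve, from a generic-
fibre valuation tower.** For `p ≥ 5` and rings `R̂ → 𝒪 → K₀ → F`, `𝒪 → S → F`, `S → k`,
`R̂ → K → K₀` as in the module docstring, the hypothesis package of the tree's
`mazur_tate_sigma_existsUnique_of_veluKernelData` holds for `p`: Blakestad–Grant's Prop. 7 for the
canonical subgroup `𝒢 = 𝓔[p] ∩ 𝓔₁` over `F` — `φ_ψ = p·D_𝒢` (eq. (4)), lifts `U₀ ≡ Xᵖ`,
`M₀ ≡ fⁿ`, `A₀ℓ₀⁴ ≡ A₄ᵖ`, `B₀ℓ₀⁶ ≡ A₆ᵖ (mod p)` over `R̂` with `f·M₀² = U₀³ + A₀U₀φ⁴ + B₀φ⁶`,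
`U₀'φ - 2U₀φ' = pM₀`, and the Kohel form `U₀ = (pX - T₀)D² - 𝓛(D)` over `K`.
[Blakestad–Grant 2023, Prop. 7; Vélu 1971; Kohel 1996 §2.4] [cite: BlakestadGrant2023, Prop. 7] -/
theorem exists_veluKernelData_of_rings (hp5 : 5 ≤ p)
    {𝒪 K₀ F S k : Type*} [CommRing 𝒪] [Field K₀] [Field F] [IsAlgClosed F] [CharZero F]
    [CommRing S] [IsLocalRing S] [Algebra S F] [CommRing k] [CharP k p]
    {Γ₀ : Type*} [LinearOrderedCommGroupWithZero Γ₀] {v : Valuation F Γ₀} (hv : v.Integers S)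
    (jR : completeRing p →+* 𝒪) (j : 𝒪 →+* K₀) (ι₀ : K₀ →+* F) (ι : 𝒪 →+* S) (π : S →+* k)
    (iK : completeRingQ p →+* K₀)
    (hcomm : (algebraMap S F).comp ι = ι₀.comp j)
    (hiK : iK.comp (algebraMap (completeRing p) (completeRingQ p)) = j.comp jR)
    (hji : Function.Injective j) (hjR : Function.Injective jR) (hfS : Function.Injective (algebraMap S F))
    (hOK : ∀ x : K₀, ι₀ x ∈ Set.range (algebraMap S F) → x ∈ Set.range j)
    (hker : ∀ c : 𝒪, π (ι c) = 0 → (p : 𝒪) ∣ c)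
    (hpS : ι (p : 𝒪) ∈ IsLocalRing.maximalIdeal S)
    (h3 : IsUnit (3 : 𝒪)) (h2 : ¬ (p : 𝒪) ∣ 2) (hprime : (Ideal.span {(p : 𝒪)}).IsPrime) (hpO : (p : 𝒪) ≠ 0)
    (hdesc : ∀ (x : completeRingQ p) (y : 𝒪), iK x = j y → ∃ r, algebraMap (completeRing p) (completeRingQ p) r = x)
    (hint : ∀ q : S[X], q.Monic → ∀ c : F, (q.map (algebraMap S F)).IsRoot c → c ∈ Set.range (algebraMap S F)) :
    ∃ (n : ℕ) (_ : 2 * n + 1 = p) (φO U₀ M₀ : (completeRing p)[X]) (A₀ B₀ : completeRing p)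
        (D : (completeRingQ p)[X]) (T₀ : completeRingQ p),
        φO.natDegree ≤ n ∧ φO.coeff n = p ∧ (∀ i, 1 ≤ i → (p : completeRing p) ∣ φO.coeff i) ∧
        IsUnit (φO.coeff 0) ∧
        U₀.natDegree ≤ p ∧ U₀.coeff p = 1 ∧ (∀ i, (p : completeRing p) ∣ (U₀ - Polynomial.X ^ p).coeff i) ∧
        M₀.natDegree ≤ 3 * n ∧ M₀.coeff (3 * n) = 1 ∧
        (∀ i, (p : completeRing p) ∣ (M₀ - (Polynomial.X ^ 3 + Polynomial.C (univA₄ p) * Polynomial.X +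
          Polynomial.C (univA₆ p)) ^ n).coeff i) ∧
        (Polynomial.X ^ 3 + Polynomial.C (univA₄ p) * Polynomial.X + Polynomial.C (univA₆ p)) * M₀ ^ 2 =
          U₀ ^ 3 + Polynomial.C A₀ * U₀ * φO ^ 4 + Polynomial.C B₀ * φO ^ 6 ∧
        (p : completeRing p) ∣ A₀ * φO.coeff 0 ^ 4 - univA₄ p ^ p ∧
        (p : completeRing p) ∣ B₀ * φO.coeff 0 ^ 6 - univA₆ p ^ p ∧
        Polynomial.derivative U₀ * φO - 2 * U₀ * Polynomial.derivative φO = Polynomial.C (p : completeRing p) * M₀ ∧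
        Polynomial.C (p : completeRingQ p) * D = φO.map (algebraMap (completeRing p) (completeRingQ p)) ∧
        U₀.map (algebraMap (completeRing p) (completeRingQ p)) =
          (Polynomial.C (p : completeRingQ p) * Polynomial.X - Polynomial.C T₀) * D ^ 2 -
            ((universalCurve p).map (algebraMap (completeRing p) (completeRingQ p))).veluLogOp D := by
  -- notation
  set R := completeRing p with hR
  set K := completeRingQ p with hK
  set αK : R →+* K := algebraMap R K with hαK
  haveI : IsDomain R := isDomain_completeRing p hp5
  have hαKinj : Function.Injective αK := algebraMap_completeRingQ_injective p hp5
  set fS : S →+* F := algebraMap S F with hfS_def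
  set ιF : R →+* F := fS.comp (ι.comp jR) with hιF
  set ιKF : K →+* F := ι₀.comp iK with hιKF
  have hιF' : ιF = (ι₀.comp j).comp jR := by rw [hιF, ← RingHom.comp_assoc, hcomm]
  have hιKF' : ιKF.comp αK = ιF := by rw [hιKF, RingHom.comp_assoc, hiK, hιF', RingHom.comp_assoc]
  have hιFinj : Function.Injective ιF := by
    rw [hιF']; exact (ι₀.injective.comp hji).comp hjR
  have hιKFinj : Function.Injective ιKF := by
    -- `x = r/pᵃ ↦ 0` forces `r = 0`
    intro x y hxy
    rw [← sub_eq_zero] at hxy ⊢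
    set z := x - y with hz
    have hz0 : ιKF z = 0 := by rw [hz, map_sub]; exact hxy
    obtain ⟨⟨r, m⟩, hrm⟩ := IsLocalization.surj (Submonoid.powers (p : R)) z
    obtain ⟨a, ha⟩ := m.2
    have hpa : IsUnit (αK (m : R)) := by
      rw [← ha, map_pow, hαK, map_natCast]; exact (isUnit_natCast_prime_completeRingQ p).pow a
    have hzr : z * αK (m : R) = αK r := hrm
    have hr0 : ιF r = 0 := by
      rw [← hιKF', RingHom.comp_apply, ← hzr, map_mul, hz0, zero_mul]
    have : r = 0 := hιFinj (by rw [hr0, RingHom.map_zero])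
    rw [this, RingHom.map_zero] at hzr
    exact (hpa.mul_left_eq_zero).mp hzr
  -- the canonical factor of `ψ_p` over `R̂`
  obtain ⟨n, hn, φ, ξ, hfact, hξm, hξdeg, hφn, hφlc, hφ0, hφi⟩ := exists_canonicalFactor p hp5
  have hn1 : 1 ≤ n := by omega
  have hpp : p.Prime := Fact.out
  -- curves
  set E := universalCurve p with hE
  set ES : WeierstrassCurve S := E.map (ι.comp jR) with hES
  set EF : WeierstrassCurve F := E.map ιF with hEF
  have hEF' : ES.baseChange F = EF := by
    rw [hES, hEF, WeierstrassCurve.baseChange, WeierstrassCurve.map_map]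
  haveI hEFshort : EF.IsShortNF := by
    rw [hEF, hE]; refine ⟨?_, ?_, ?_⟩ <;> simp [universalCurve]
  have hΔF : EF.Δ ≠ 0 := by
    rw [hEF, WeierstrassCurve.map_Δ]
    intro h0
    have hΔ : E.Δ = 0 := hιFinj (by rw [h0, RingHom.map_zero])
    exact delta_universalCurve_not_mem_span p hp5 (by rw [← hE, hΔ]; exact Ideal.zero_mem _)
  haveI : EF.IsElliptic := ⟨isUnit_iff_ne_zero.mpr hΔF⟩
  haveI : (ES.baseChange F).IsElliptic := by rw [hEF']; infer_instance
  -- the factorisation over `F` and the canonical subgroup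
  set φF := φ.map ιF with hφF
  set ξF := ξ.map ιF with hξF
  have hfactF : (ES.baseChange F).preΨ' p = φF * ξF := by
    rw [hEF', hEF, WeierstrassCurve.map_preΨ', hfact, Polynomial.map_mul]
  have hξroots : ∀ c, ξF.IsRoot c → c ∈ Set.range (algebraMap S F) := fun c hc => by
    refine hint (ξ.map (ι.comp jR)) (hξm.map _) c ?_
    rwa [Polynomial.map_map]
  have hφi' : ∀ i, 1 ≤ i → (p : 𝒪) ∣ (φ.map jR).coeff i := fun i hi => by
    have h := map_dvd jR (Ideal.mem_span_singleton.mp (hφi i hi))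
    rwa [map_natCast, ← Polynomial.coeff_map] at h
  have hφunit : ∀ a : S, IsUnit (((φ.map jR).map ι).eval a) := fun a =>
    isUnit_eval_map ι hpS hφi' (by rw [Polynomial.coeff_map]; exact hφ0.map jR) a
  have hφroots : ∀ c, φF.IsRoot c → c ∉ Set.range (algebraMap S F) := by
    rintro c hc ⟨a, rfl⟩
    have hc' := hc
    rw [Polynomial.IsRoot.def, hφF, hιF, ← Polynomial.map_map, ← Polynomial.map_map, Polynomial.eval_map,
      Polynomial.eval₂_at_apply] at hc'
    exact (hφunit a).ne_zero (hfS (by rw [hc', RingHom.map_zero]))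
  have hφFn : φF.natDegree = n := by rw [hφF, Polynomial.natDegree_map_eq_of_injective hιFinj, hφn]
  obtain ⟨G₁, hG₁, hcard₁, hxvals₁, hφD₁, -, -⟩ :=
    ES.exists_canonicalKernel hv hn hn1 hfactF hφFn hξroots hφroots
  -- transport to the curve `EF⁄F` (the form used by `VeluKernelReductionProofs`)
  have hEFF : ES.baseChange F = EF.baseChange F := by
    rw [hEF']
    show EF = EF.map (algebraMap F F)
    rw [Algebra.algebraMap_self, WeierstrassCurve.map_id]
  obtain ⟨G, hG, hxv, hDG, hUG, hMG, hcardG, hsumG⟩ := exists_kernel_cast hEFF hG₁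
  have hcard : 2 * (veluXVals G).card + 1 = p := by rw [hxv]; exact hcard₁
  have hncard : (veluXVals G).card = n := by omega
  have hpF : ιF (p : R) = (p : F) := map_natCast ιF p
  have hφFD : φF = Polynomial.C (p : F) * veluD G := by
    rw [hDG, hφD₁, hφF, Polynomial.leadingCoeff_map_of_injective hιFinj, hφlc, hpF]
  -- inputs of `VeluKernelReductionProofs` over `𝒪`
  set φO : 𝒪[X] := φ.map jR with hφO
  have hφOF : φO.map (ι₀.comp j) = Polynomial.C (p : F) * veluD G := by
    rw [hφO, Polynomial.map_map, ← hιF', ← hφF, hφFD]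
  set A : 𝒪 := jR (univA₄ p) with hAdef
  set B : 𝒪 := jR (univA₆ p) with hBdef
  have hA : ι₀ (j A) = EF.a₄ := by
    rw [hAdef, hEF, WeierstrassCurve.map_a₄, hιF', hE]; rfl
  have hB : ι₀ (j B) = EF.a₆ := by
    rw [hBdef, hEF, WeierstrassCurve.map_a₆, hιF', hE]; rfl
  -- the roots of the `2`-division cubic are integral
  set qS : S[X] := Polynomial.X ^ 3 + Polynomial.C ES.a₄ * Polynomial.X + Polynomial.C ES.a₆ with hqS
  have hqSm : qS.Monic := by
    have : qS = Polynomial.X ^ 3 + (Polynomial.C ES.a₄ * Polynomial.X + Polynomial.C ES.a₆) := by rw [hqS, add_assoc]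
    rw [this]
    refine Polynomial.monic_X_pow_add ((Polynomial.degree_add_le _ _).trans_lt ?_)
    refine max_lt ((Polynomial.degree_C_mul_X_le _).trans_lt (by exact_mod_cast (by norm_num : (1 : ℕ) < 3)))
      ((Polynomial.degree_C_le).trans_lt (by exact_mod_cast (by norm_num : (0 : ℕ) < 3)))
  have hqSdeg : qS.natDegree = 3 := by
    rw [hqS]; compute_degree!
  have hES₄ : fS ES.a₄ = EF.a₄ := by rw [← hEF']; rfl
  have hES₆ : fS ES.a₆ = EF.a₆ := by rw [← hEF']; rfl
  have hqF : qS.map fS = veluF (EF.baseChange F) := by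
    rw [hqS, veluF]
    simp only [Polynomial.map_add, Polynomial.map_mul, Polynomial.map_pow, Polynomial.map_X, Polynomial.map_C, hES₄, hES₆]
    rfl
  have hsplit : (qS.map fS).Splits := IsAlgClosed.splits _
  have hcard3 : (qS.map fS).roots.card = 3 := by
    rw [Polynomial.splits_iff_card_roots.mp hsplit, hqSm.natDegree_map, hqSdeg]
  obtain ⟨r₀, r₁, r₂, hroots⟩ := Multiset.card_eq_three.mp hcard3
  have hq0 : qS.map fS ≠ 0 := (hqSm.map fS).ne_zero
  have hri : ∀ r, r ∈ (qS.map fS).roots → ∃ t : S, fS t = r := fun r hr =>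
    hint qS hqSm r ((Polynomial.mem_roots hq0).mp hr)
  obtain ⟨s₀, hs₀⟩ := hri r₀ (by rw [hroots]; simp)
  obtain ⟨s₁, hs₁⟩ := hri r₁ (by rw [hroots]; simp)
  obtain ⟨s₂, hs₂⟩ := hri r₂ (by rw [hroots]; simp)
  set sv : Fin 3 → S := ![s₀, s₁, s₂] with hsv
  have hfac : veluF (EF.baseChange F) =
      (Polynomial.X - Polynomial.C (fS (sv 0))) * (Polynomial.X - Polynomial.C (fS (sv 1))) *
        (Polynomial.X - Polynomial.C (fS (sv 2))) := by
    rw [← hqF, hsplit.eq_prod_roots_of_monic (hqSm.map fS), hroots]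
    have h0 : sv 0 = s₀ := rfl
    have h1 : sv 1 = s₁ := rfl
    have h2 : sv 2 = s₂ := rfl
    rw [h0, h1, h2, hs₀, hs₁, hs₂]
    simp only [Multiset.insert_eq_cons, Multiset.map_cons, Multiset.prod_cons, Multiset.map_singleton,
      Multiset.prod_singleton]
    ring
  -- units `φ(rᵢ)`
  set uv : Fin 3 → Sˣ := fun i => (hφunit (sv i)).unit with huv
  have hu : ∀ i, (uv i : S) = (φO.map ι).eval (sv i) := fun i => IsUnit.unit_spec _
  -- Blakestad–Grant Prop. 7 (a) over `𝒪` (`VeluKernelReductionProofs`)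
  obtain ⟨U₁, hU₁, hU₁p⟩ := EF.exists_veluU_lift ι₀ j fS ι π hG hcomm hfS hOK hker h3 hφOF hφi' hA hB hfac uv hu hcard
  obtain ⟨M₁, hM₁, hM₁m, hM₁p⟩ := EF.exists_veluMD_lift ι₀ j fS ι π hG hcomm hfS hji hker hprime h2 hφOF hφi' hA hB
    hfac uv hu hcard hU₁ hU₁p
  have hℓ : IsUnit (φO.coeff 0) := by rw [hφO, Polynomial.coeff_map]; exact hφ0.map jR
  obtain ⟨A₁, B₁, hA₁, hB₁, hid₁, hA₁p, hB₁p⟩ := EF.exists_veluAB_lift ι₀ j hG hji hprime hφOF hφi' hℓ hA hB hcard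
    hU₁ hU₁p hM₁ hM₁p
  -- degrees of Vélu's polynomials over `F`
  have hcardG1 : (G.erase 0).card + 1 = p := by rw [card_erase_zero_eq hG, hcard]
  have hUmon : (veluU G).Monic := monic_veluU hG
  have hUdeg : (veluU G).natDegree = p := by rw [natDegree_veluU hG, hcardG1]
  have hDmon : (veluD G).Monic := monic_veluD G
  have hDdeg : (veluD G).natDegree = n := by rw [natDegree_veluD, hncard]
  have hMDmon : (veluMD G).Monic := monic_veluMD hG
  have hMDdeg : (veluMD G).natDegree = 3 * n := by rw [natDegree_veluMD hG, hncard]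
  -- the `K`-side: `D = φ/p`, `T₀`, `U`, `M`
  set pK : K := (p : K) with hpKdef
  have hpK : IsUnit pK := isUnit_natCast_prime_completeRingQ p
  set pinv : K := ↑hpK.unit⁻¹ with hpinv
  have hppinv : pK * pinv = 1 := hpK.mul_val_inv
  have hαKp : αK (p : R) = pK := by rw [hαK, map_natCast]
  have hpKF : ιKF pK = (p : F) := by rw [hpKdef, map_natCast]
  have hpF0 : (p : F) ≠ 0 := Nat.cast_ne_zero.mpr hpp.ne_zero
  set EK : WeierstrassCurve K := E.map αK with hEK
  have hEKF : EK.map ιKF = EF := by rw [hEK, WeierstrassCurve.map_map, hιKF', hEF]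
  set φK : K[X] := φ.map αK with hφK
  have hφKF : φK.map ιKF = φF := by rw [hφK, Polynomial.map_map, hιKF', hφF]
  set D : K[X] := Polynomial.C pinv * φK with hD
  have hpD : Polynomial.C pK * D = φK := by
    rw [hD, ← mul_assoc, ← Polynomial.C_mul, hppinv, Polynomial.C_1, one_mul]
  have hDF : D.map ιKF = veluD G := by
    have h := congrArg (Polynomial.map ιKF) hpD
    rw [Polynomial.map_mul, Polynomial.map_C, hpKF, hφKF, hφFD] at h
    exact mul_left_cancel₀ (Polynomial.C_ne_zero.mpr hpF0) h
  have hDmonK : D.Monic := Polynomial.monic_of_injective hιKFinj (by rw [hDF]; exact hDmon)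
  have hDdegK : D.natDegree = n := by rw [← Polynomial.natDegree_map_eq_of_injective hιKFinj, hDF, hDdeg]
  set T₀ : K := -2 * D.coeff (n - 1) with hT₀
  have hT₀F : ιKF T₀ = ∑ v ∈ G.erase 0, xOf v := by
    have hsum : ∑ v ∈ G.erase 0, xOf v = ∑ c ∈ veluXVals G, (c + c) :=
      sum_erase_zero_eq_sum_veluXVals hG xOf (fun c => c + c) fun v _ => by rw [xOf_neg]
    have hvieta : (veluD G).coeff (n - 1) = -∑ c ∈ veluXVals G, c := by
      rw [veluD, ← hncard]
      have h := Polynomial.prod_X_sub_C_coeff_card_pred (veluXVals G) (fun c => c) (by rw [hncard]; omega)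
      simpa using h
    rw [hT₀, map_mul, map_neg, map_ofNat, ← Polynomial.coeff_map, hDF, hvieta, hsum, Finset.sum_add_distrib]
    ring
  set UK : K[X] := (Polynomial.C pK * Polynomial.X - Polynomial.C T₀) * D ^ 2 - EK.veluLogOp D with hUK
  have hEFid : EF.baseChange F = EF := by
    show EF.map (algebraMap F F) = EF
    rw [Algebra.algebraMap_self, WeierstrassCurve.map_id]
  have hUKF : UK.map ιKF = veluU G := by
    rw [hUK, Polynomial.map_sub, Polynomial.map_mul, Polynomial.map_sub, Polynomial.map_mul, Polynomial.map_C,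
      Polynomial.map_X, Polynomial.map_C, Polynomial.map_pow, WeierstrassCurve.map_veluLogOp, hEKF, hDF, hpKF, hT₀F,
      veluU_eq_logForm hG two_ne_zero, hcardG1]
    congr 1
  set MK : K[X] := Polynomial.derivative UK * D - 2 * UK * Polynomial.derivative D with hMK
  have hMKF : MK.map ιKF = veluMD G := by
    have h1 : (Polynomial.derivative UK).map ιKF = Polynomial.derivative (veluU G) := by
      rw [← Polynomial.derivative_map, hUKF]
    have h2 : (Polynomial.derivative D).map ιKF = Polynomial.derivative (veluD G) := by
      rw [← Polynomial.derivative_map, hDF]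
    rw [hMK, veluMD]
    simp only [Polynomial.map_sub, Polynomial.map_mul, Polynomial.map_ofNat, h1, h2, hUKF, hDF]
  -- descend `U`, `M` to `R̂`
  have hU₁F : U₁.map (ι₀.comp j) = UK.map (ι₀.comp iK) := by rw [hU₁, ← hιKF, hUKF]
  obtain ⟨U₀, hU₀K, hU₀O⟩ := exists_poly_descend αK jR j iK ι₀ hiK hji hdesc hU₁F.symm
  have hM₁F : M₁.map (ι₀.comp j) = MK.map (ι₀.comp iK) := by rw [hM₁, ← hιKF, hMKF]
  obtain ⟨M₀, hM₀K, hM₀O⟩ := exists_poly_descend αK jR j iK ι₀ hiK hji hdesc hM₁F.symm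
  -- Vélu's coefficients `a, b` are `K`-rational: read them off `fM² - U³ = aUD⁴ + bD⁶`
  set fR : R[X] := Polynomial.X ^ 3 + Polynomial.C (univA₄ p) * Polynomial.X + Polynomial.C (univA₆ p) with hfR
  have hfRF : fR.map ιF = veluF (EF.baseChange F) := by
    rw [hfR, veluF, hEFid, hEF]
    simp only [Polynomial.map_add, Polynomial.map_mul, Polynomial.map_pow, Polynomial.map_X, Polynomial.map_C,
      WeierstrassCurve.map_a₄, WeierstrassCurve.map_a₆, hE]
    rfl
  have hfRO : fR.map jR = Polynomial.X ^ 3 + Polynomial.C A * Polynomial.X + Polynomial.C B := by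
    rw [hfR]; simp only [Polynomial.map_add, Polynomial.map_mul, Polynomial.map_pow, Polynomial.map_X,
      Polynomial.map_C, hAdef, hBdef]
  set QK : K[X] := fR.map αK * MK ^ 2 - UK ^ 3 with hQK
  have hidF := veluF_mul_veluMD_sq (W := EF) hG
  set a : F := veluA G with ha
  set b : F := veluB G with hb
  have hQKF : QK.map ιKF = Polynomial.C a * veluU G * veluD G ^ 4 + Polynomial.C b * veluD G ^ 6 := by
    rw [hQK, Polynomial.map_sub, Polynomial.map_mul, Polynomial.map_pow, Polynomial.map_pow, Polynomial.map_map, hιKF',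
      hfRF, hMKF, hUKF]
    linear_combination hidF
  have hUD4 : (veluU G * veluD G ^ 4).Monic := hUmon.mul (hDmon.pow 4)
  have hUD4deg : (veluU G * veluD G ^ 4).natDegree = 6 * n + 1 := by
    rw [hUmon.natDegree_mul (hDmon.pow 4), Polynomial.natDegree_pow, hUdeg, hDdeg]; omega
  have hD6deg : (veluD G ^ 6).natDegree = 6 * n := by rw [Polynomial.natDegree_pow, hDdeg]
  have hD6mon : (veluD G ^ 6).Monic := hDmon.pow 6
  set aK : K := QK.coeff (6 * n + 1) with haK
  have haKF : ιKF aK = a := by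
    rw [haK, ← Polynomial.coeff_map, hQKF, Polynomial.coeff_add, mul_assoc, Polynomial.coeff_C_mul,
      Polynomial.coeff_C_mul, ← hUD4deg, hUD4.coeff_natDegree, hUD4deg,
      Polynomial.coeff_eq_zero_of_natDegree_lt (by rw [hD6deg]; omega)]
    ring
  set bK : K := (QK - Polynomial.C aK * UK * D ^ 4).coeff (6 * n) with hbK
  have hbKF : ιKF bK = b := by
    rw [hbK, ← Polynomial.coeff_map, Polynomial.map_sub, Polynomial.map_mul, Polynomial.map_mul, Polynomial.map_C,
      Polynomial.map_pow, hQKF, haKF, hUKF, hDF, add_sub_cancel_left, Polynomial.coeff_C_mul, ← hD6deg,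
      hD6mon.coeff_natDegree, mul_one]
  -- descend `A₀ = a/p⁴`, `B₀ = b/p⁶`
  have hpinvF : ιKF pinv * (p : F) = 1 := by
    rw [← hpKF, mul_comm, ← map_mul, hppinv, map_one]
  have hxA : iK (aK * pinv ^ 4) = j A₁ := by
    apply ι₀.injective
    have h1 : ι₀ (j A₁) = a * (ιKF pinv) ^ 4 := by
      rw [← hA₁]
      linear_combination -(ι₀ (j A₁)) * ((ιKF pinv * (p : F)) ^ 3 + (ιKF pinv * (p : F)) ^ 2 +
        ιKF pinv * (p : F) + 1) * hpinvF
    rw [h1, ← RingHom.comp_apply, ← hιKF, map_mul, map_pow, haKF]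
  obtain ⟨A₀, hA₀⟩ := hdesc _ _ hxA
  have hA₀O : jR A₀ = A₁ := hji (by rw [← RingHom.comp_apply, ← hiK, RingHom.comp_apply, hA₀, hxA])
  have hxB : iK (bK * pinv ^ 6) = j B₁ := by
    apply ι₀.injective
    have h1 : ι₀ (j B₁) = b * (ιKF pinv) ^ 6 := by
      rw [← hB₁]
      linear_combination -(ι₀ (j B₁)) * ((ιKF pinv * (p : F)) ^ 5 + (ιKF pinv * (p : F)) ^ 4 +
        (ιKF pinv * (p : F)) ^ 3 + (ιKF pinv * (p : F)) ^ 2 + ιKF pinv * (p : F) + 1) * hpinvF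
    rw [h1, ← RingHom.comp_apply, ← hιKF, map_mul, map_pow, hbKF]
  obtain ⟨B₀, hB₀⟩ := hdesc _ _ hxB
  have hB₀O : jR B₀ = B₁ := hji (by rw [← RingHom.comp_apply, ← hiK, RingHom.comp_apply, hB₀, hxB])
  -- images over `F` of the descended data
  have hU₀F : U₀.map ιF = veluU G := by rw [hιF', ← Polynomial.map_map, hU₀O, hU₁]
  have hM₀F : M₀.map ιF = veluMD G := by rw [hιF', ← Polynomial.map_map, hM₀O, hM₁]
  have hpKO : j (jR (p : R)) ≠ 0 := by
    rw [map_natCast]; intro h0; exact hpO (hji (by rw [h0, RingHom.map_zero]))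
  have hpKu : IsUnit (αK (p : R)) := by rw [hαKp]; exact hpK
  have hdvd : ∀ r : R, (p : 𝒪) ∣ jR r → (p : R) ∣ r := fun r hr =>
    dvd_descend αK jR j iK hiK hαKinj hdesc hpKu hpKO (by rwa [map_natCast])
  -- the fields
  have hU₀deg : U₀.natDegree ≤ p := by
    rw [← Polynomial.natDegree_map_eq_of_injective hιFinj, hU₀F, hUdeg]
  have hU₀p : U₀.coeff p = 1 := by
    apply hιFinj
    rw [← Polynomial.coeff_map, hU₀F, map_one, ← hUdeg, hUmon.coeff_natDegree]
  have hU₀cong : ∀ i, (p : R) ∣ (U₀ - Polynomial.X ^ p).coeff i := fun i => by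
    refine hdvd _ ?_
    have h := hU₁p i
    rwa [← hU₀O, ← Polynomial.map_X (f := jR), ← Polynomial.map_pow, ← Polynomial.map_sub, Polynomial.coeff_map] at h
  have hM₀deg : M₀.natDegree ≤ 3 * n := by
    rw [← Polynomial.natDegree_map_eq_of_injective hιFinj, hM₀F, hMDdeg]
  have hM₀top : M₀.coeff (3 * n) = 1 := by
    apply hιFinj
    rw [← Polynomial.coeff_map, hM₀F, map_one, ← hMDdeg, hMDmon.coeff_natDegree]
  have hM₀cong : ∀ i, (p : R) ∣ (M₀ - fR ^ n).coeff i := fun i => by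
    refine hdvd _ ?_
    have h := hM₁p i
    rwa [hncard, ← hM₀O, ← hfRO, ← Polynomial.map_pow, ← Polynomial.map_sub, Polynomial.coeff_map] at h
  have hidR : fR * M₀ ^ 2 = U₀ ^ 3 + Polynomial.C A₀ * U₀ * φ ^ 4 + Polynomial.C B₀ * φ ^ 6 := by
    apply Polynomial.map_injective jR hjR
    simp only [Polynomial.map_add, Polynomial.map_mul, Polynomial.map_pow, Polynomial.map_C, hfRO, hM₀O, hU₀O, hA₀O,
      hB₀O]
    exact hid₁
  have hA₀cong : (p : R) ∣ A₀ * φ.coeff 0 ^ 4 - univA₄ p ^ p := by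
    refine hdvd _ ?_
    have h := hA₁p
    rwa [← hA₀O, hφO, Polynomial.coeff_map, hAdef, ← map_pow, ← map_pow, ← map_mul, ← map_sub] at h
  have hB₀cong : (p : R) ∣ B₀ * φ.coeff 0 ^ 6 - univA₆ p ^ p := by
    refine hdvd _ ?_
    have h := hB₁p
    rwa [← hB₀O, hφO, Polynomial.coeff_map, hBdef, ← map_pow, ← map_pow, ← map_mul, ← map_sub] at h
  have hderiv : Polynomial.derivative U₀ * φ - 2 * U₀ * Polynomial.derivative φ = Polynomial.C (p : R) * M₀ := by
    apply Polynomial.map_injective ιF hιFinj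
    have hφF' : φ.map ιF = Polynomial.C (p : F) * veluD G := by rw [← hφF, hφFD]
    have h1 : (Polynomial.derivative U₀).map ιF = Polynomial.derivative (veluU G) := by
      rw [← Polynomial.derivative_map, hU₀F]
    have h2 : (Polynomial.derivative φ).map ιF = Polynomial.derivative (Polynomial.C (p : F) * veluD G) := by
      rw [← Polynomial.derivative_map, hφF']
    rw [Polynomial.map_sub, Polynomial.map_mul, Polynomial.map_mul, Polynomial.map_mul, h1, h2, Polynomial.map_mul,
      Polynomial.map_C, Polynomial.map_ofNat, hU₀F, hφF', hM₀F, hpF, veluMD, Polynomial.derivative_mul,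
      Polynomial.derivative_C, zero_mul, zero_add]
    ring
  refine ⟨n, hn, φ, U₀, M₀, A₀, B₀, D, T₀, hφn.le, ?_, fun i hi => Ideal.mem_span_singleton.mp (hφi i hi), hφ0,
    hU₀deg, hU₀p, hU₀cong, hM₀deg, hM₀top, hM₀cong, hidR, hA₀cong, hB₀cong, hderiv, ?_, ?_⟩
  · rw [← hφn]; exact hφlc
  · rw [hpD]
  · rw [hU₀K]

end Main

end Literature.NumberTheory.EllipticCurves.UniversalOrdinary
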